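import Literature.AlgebraicGeometry.HodgeTheory.MotivatedClassesPushforward
import Literature.AlgebraicGeometry.HodgeTheory.MotivatedClassesPointAuxiliary
import Literature.AlgebraicGeometry.HodgeTheory.MotivatedClassesAssembly
import HarnessLib

/-!
# André 1996 Prop. 2.1 (ii), first inclusion — the Künneth core reduced to Lemme 1.3.2 for the pair
# `(*_η β, [Z])` (singular cohomology of smooth projective complex varieties)

The companion file `…MotivatedPullbackFstReduction` reduces the stub (Y. André, *Pour une théorie
inconditionnelle des motifs*, Publ. Math. IHÉS 83 (1996), Prop. 2.1 (ii), first inclusion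
`pr_X^*(A_motᵖ(X)) ⊆ A_motᵖ(X ⊗ Z)`) to its **Künneth core** by Gysin base change: for generator data
(`Z`, `X`, `Y` smooth projective of dimensions `l`, `n`, `m`, an orientation family `μ`, a
polarisation class `η` of `X ⊗ Y`, algebraic `α ∈ Nᵃ`, `β ∈ Nᵇ` on `X ⊗ Y`, `b + b' = n + m`,
`a + b' = p + m`, `p ≤ n`) the class `(Z ◁ pr_X)_*(pr_{XY}^* α ∪ pr_{XY}^*(*_η β))` must lie in
`A_motᵖ(Z ⊗ X)_ℂ`. André (p. 15): "on conclut en appliquant le lemme 1.3.2" — the pulled-back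
involution `pr_{XY}^*(*_η β) = [Z] ⊗ *_η β` is a combination of classes `γ ∪ *_θ δ` with `γ`, `δ`
algebraic on `Z × (X × Y)` and `θ` the product polarisation (Lemme 1.3.2 through Künneth), after
which each term `(pr^* α ∪ γ) ∪ *_θ δ` is a generator and its push-forward to `Z × X` is motivated.

This file proves that last implication on the real carriers:

* `exists_complexGysin_iso_eq_smul_map` — the Gysin morphism of an ISOMORPHISM `e : A ≅ B` of smooth
  projective varieties is a scalar multiple of the pull-back along `e⁻¹` (`e_! = (e⁻¹)^*` for the
  transported orientation, Fulton App. B (5)–(7), the tree's `gysinMap_comap_symm_eq_map_symm`; the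
  orientation of `B(ℂ)` in the family differs from the transported one by a unit, `B(ℂ)` connected,
  Hatcher Thm. 3.26 (b));
* `motivatedPullbackFst_core_of_lemma132` — **the Künneth core GRANTED Lemme 1.3.2 for the pair
  `(*_η β, [Z])` and the multiplicativity of algebraic classes**: IF for all smooth projective `Z`, `W`
  (dimensions `l`, `d`), every polarisation class `η` of `W` and every algebraic `β ∈ Nᵇ H²ᵇ(W(ℂ))`
  (`b + b' = d`) the class `pr_W^*(*_η β) ∈ H^{2b'}((Z ⊗ W)(ℂ))` lies in the `ℂ`-span of the classes
  `γ ∪ *_θ δ`, `θ` a polarisation class of the `(l + d)`-fold `Z ⊗ W`, `γ ∈ Nᶜ`, `δ ∈ Nᵉ` algebraic on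
  `Z ⊗ W` (hypothesis `h132`: André's Lemme 1.3.2, qualitative form, for `x = *_η β ∈ H(W)` and
  `y = [Z] = *(η_Z^l) ∈ H⁰(Z)`, with the hard Lefschetz theorem for the exterior sum `η_Z ⊠ 1 + 1 ⊠ η`,
  §1.3, making it an `IsPolarizationClass`), and IF algebraic classes are closed under cup product
  (`hV = Voisin2003_cupProduct_algebraicClasses`, Voisin II Prop. 9.20 — the line's
  `stub_cupProductAlgebraic`), THEN the Künneth core holds: by linearity in the span, for a term
  `γ ∪ *_θ δ` one has `pr^* α ∪ (γ ∪ *_θ δ) = (pr^* α ∪ γ) ∪ *_θ δ` with `pr^* α ∪ γ` algebraic (flat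
  pull-back `map_snd_mem_supportedClasses` and `hV`), a POINT generator of `A_mot^{p+m}(Z ⊗ (X ⊗ Y))`
  (`isMotivatedClass_of_eq_cupProduct_lefschetzInvolution`, auxiliary variety `Spec ℂ`); and
  `(Z ◁ pr_X)_* = pr_{ZX*} ∘ (a⁻¹)_!` for the associator `a : (Z ⊗ X) ⊗ Y ≅ Z ⊗ (X ⊗ Y)`
  (`complexGysin_comp`), where `(a⁻¹)_!` is a multiple of `a^*`, which preserves motivated classes
  (`map_mem_motivatedClasses_of_iso`), and `pr_{ZX*}(A_mot((Z ⊗ X) ⊗ Y)) ⊆ A_mot(Z ⊗ X)` is Prop. 2.1 (ii),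
  SECOND inclusion, proved in the tree (`complexGysin_fst_mem_motivatedClasses`);
* `stub_motivatedPullbackFst_core_of_lemma132` — the same in implication form (registered sub-goal).

With `stub_motivatedPullbackFst_of_core` (companion file) and `andreMotivatedPullback_of_cupProduct_of_mapFst`
(`…AndreMotivatedPullback`), the leaf (A5) of André's Thm. 0.5 on the real carriers is thereby reduced to
`Voisin2003_cupProduct_algebraicClasses` and `h132` alone.

No definition and no named fact is introduced; `h132` and `hV` are verbatim hypotheses.

## References

* [Andre1996Motifs] Y. André, Pour une théorie inconditionnelle des motifs, Publ. Math. IHÉS 83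
  (1996) 5–49: §1.3 Lemme 1.3.2 (p. 13), §2.1 Déf. 1, Prop. 2.1 (ii) (p. 14) and proof (p. 15).
* [FultonYoungTableaux1997] W. Fulton, Young Tableaux, CUP 1997, App. B §B.1 (2), (5)–(7).
* [HatcherAT2002] A. Hatcher, Algebraic Topology, CUP 2002, §3.2 p. 211, §3.3 Thm. 3.26, Thm. 3.30.
* [VoisinHodgeII2003] C. Voisin, Hodge Theory and Complex Algebraic Geometry II, CUP 2003, §9.2.4
  Prop. 9.20.

Provenance: Literature home (family `hodge`, layer `Literature/AlgebraicGeometry/HodgeTheory`, namespace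
`Literature.AlgebraicGeometry.HodgeTheory.MotivatedPullback`) of the Summits-side `Theorems/HeckePrymWeilSummitOffWeilSectorMotivatedPullbackFstCore` (cell `pub-hodge-ring2` ∕ route files
`HeckePrymWeilSummitOffWeilSector*`, the tree's derivation of André 1996 Prop. 2.1 (ii): motivated classes are stable
under pull-back), which `Literature/` may not import; theorems only, no named fact, no definition. Nothing here bears
on `HC_CM`; no case of the Hodge conjecture is proved. Lane `lit-hodgefound`, seat p20.
-/

noncomputable section

open _root_.CategoryTheory _root_.AlgebraicGeometry MonoidalCategory CartesianMonoidalCategory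
open Literature.AlgebraicTopology.SingularHomology Literature.Geometry.Kaehler
open Literature.AlgebraicGeometry Literature.AlgebraicGeometry.Motives
  Literature.AlgebraicGeometry.HodgeTheory

namespace Literature.AlgebraicGeometry.HodgeTheory.MotivatedPullback

/-- **The Gysin morphism of an isomorphism is a multiple of the pull-back along its inverse.** For
an isomorphism `e : A ≅ B` of smooth projective complex varieties of dimension `D`, an orientation
family `μ` and `w ∈ Hᵏ(A(ℂ); ℂ)`, `e_! w = c • (e⁻¹)^* w` for some `c ∈ ℂ`: for the orientation of
`B(ℂ)` transported from `A(ℂ)` along `e(ℂ)`, `e(ℂ)_! = (e(ℂ)⁻¹)^*` (`e(ℂ)` has degree `1`, Fulton App. B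
(5)–(7); the tree's `gysinMap_comap_symm_eq_map_symm`), and the family's orientation of the connected
closed manifold `B(ℂ)` is a unit multiple of the transported one (Hatcher Thm. 3.26 (b)), under which
the Gysin map rescales (`gysinMap_eq_smul_of_fundamentalClass_eq`). (In fact `c` is a unit; only the
existence of a scalar is recorded.) For `k > 2D`, `Hᵏ(A(ℂ); ℂ) = 0`.
[cite: FultonYoungTableaux1997, Appendix B §B.1 (5)–(7)] [cite: HatcherAT2002, §3.3 Thm. 3.26 (b)] -/
theorem exists_complexGysin_iso_eq_smul_map (μ : OrientationFamily) {D : ℕ} {A B : SchemeOver ℂ}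
    (hA : IsSmoothProjective D A) (hB : IsSmoothProjective D B) (e : A ≅ B) {k : ℕ}
    (h : k + 2 * D = k + 2 * D) (w : complexBetti A k) :
    ∃ c : ℂ, complexGysin μ hA hB e.hom h w = c • complexBetti.map e.inv k w := by
  classical
  by_cases hk : k ≤ 2 * D
  swap
  · haveI := subsingleton_complexBetti hA (show 2 * D < k by omega)
    refine ⟨0, ?_⟩
    rw [Subsingleton.elim w 0, map_zero, map_zero, smul_zero]
  have hq : k + (2 * D - k) = 2 * D := by omega
  rw [complexGysin_eq_gysinMap hA hB e.hom h hq hq, ← AlgPoints.coe_homeomorphOfIso_eq_mapContinuous]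
  set eH := AlgPoints.homeomorphOfIso (L := ℂ) e with heH
  letI := hA.chartedSpace
  haveI := ComplexPoints.compactSpace_of_isSmoothProjective hA
  haveI := ComplexPoints.t2Space_of_isSmoothProjective hA
  letI := hB.chartedSpace
  haveI := ComplexPoints.compactSpace_of_isSmoothProjective hB
  haveI := ComplexPoints.t2Space_of_isSmoothProjective hB
  haveI : ConnectedSpace (ComplexPoints B) := connectedSpace_complexPoints hB
  have hμA : (μ hA).HasPoincareDuality := μ.hasPoincareDuality hA
  -- the family's orientation of `B(ℂ)` is a unit multiple of the transported one
  obtain ⟨u, hu, -⟩ := ((μ hA).comap eH.symm).exists_unit_fundamentalClass_eq_smul (μ hB)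
  have hch : gysinMap (μ hA) (μ hB) (eH : C(ComplexPoints A, ComplexPoints B)) hq hq =
      ((u⁻¹ : ℂˣ) : ℂ) • gysinMap (μ hA) ((μ hA).comap eH.symm)
        (eH : C(ComplexPoints A, ComplexPoints B)) hq hq :=
    gysinMap_eq_smul_of_fundamentalClass_eq (hμA.comap eH.symm) (μ.hasPoincareDuality hB)
      (one_smul ℂ (μ hA).fundamentalClass).symm hu u.mul_inv _ hq hq
  refine ⟨((u⁻¹ : ℂˣ) : ℂ), ?_⟩
  rw [hch, LinearMap.smul_apply, gysinMap_comap_symm_eq_map_symm hμA eH hq w]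
  rfl

/-- **The Künneth core of Prop. 2.1 (ii), first inclusion, from Lemme 1.3.2 for `(*_η β, [Z])` and
the multiplicativity of algebraic classes** (André 1996, p. 15: "on conclut en appliquant le lemme
1.3.2"), on the real carriers. GRANTED `hV` (`Voisin2003_cupProduct_algebraicClasses`, Voisin II
Prop. 9.20) and `h132` — for `Z`, `W` smooth projective of dimensions `l`, `d`, a polarisation class
`η` of `W`, `b + b' = d` and `β ∈ Nᵇ H²ᵇ(W(ℂ); ℂ)`, the class `pr_W^*(*_η β)` lies in the `ℂ`-span of
the classes `γ ∪ *_θ δ` (`θ` a polarisation class of `Z ⊗ W` in dimension `l + d`, `γ ∈ Nᶜ`, `δ ∈ Nᵉ`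
on `Z ⊗ W`, `c + e' = b'`, `e + e' = l + d`) — the Künneth core (hypothesis of
`stub_motivatedPullbackFst_of_core`) holds: for generator data `Z, X, Y, μ, η, α, β` the class
`(Z ◁ pr_X)_*(pr_{XY}^* α ∪ pr_{XY}^*(*_η β))` lies in `A_motᵖ(Z ⊗ X)_ℂ`. Proof: the class is linear
in `pr_{XY}^*(*_η β)`, so (`h132` with `W = X ⊗ Y`) it suffices to treat `pr^* α ∪ (γ ∪ *_θ δ) =
(pr^* α ∪ γ) ∪ *_θ δ` (associativity, Hatcher §3.2), where `pr^* α ∪ γ ∈ N^{a+c}` (flat pull-back,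
`map_snd_mem_supportedClasses`, and `hV`): a point generator of `A_mot^{p+m}(Z ⊗ (X ⊗ Y))_ℂ`
(`isMotivatedClass_of_eq_cupProduct_lefschetzInvolution`). Then `Z ◁ pr_X = a⁻¹ ≫ pr_{Z⊗X}` for the
associator `a : (Z ⊗ X) ⊗ Y ≅ Z ⊗ (X ⊗ Y)`, `(Z ◁ pr_X)_* = pr_{ZX*} ∘ (a⁻¹)_!` (`complexGysin_comp`,
Fulton App. B (5)), `(a⁻¹)_!` is a multiple of `a^*` (`exists_complexGysin_iso_eq_smul_map`), which
preserves motivated classes (`map_mem_motivatedClasses_of_iso`), and `pr_{ZX*}` maps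
`A_mot^{p+m}((Z ⊗ X) ⊗ Y)` into `A_motᵖ(Z ⊗ X)` (Prop. 2.1 (ii), second inclusion, the tree's
`complexGysin_fst_mem_motivatedClasses`). [cite: Andre1996Motifs, Prop. 2.1 (ii) (p. 14), proof (p. 15) and Lemme 1.3.2 (p. 13)]
[cite: VoisinHodgeII2003, §9.2.4 Prop. 9.20] [cite: FultonYoungTableaux1997, Appendix B §B.1 (5)] -/
theorem motivatedPullbackFst_core_of_lemma132 (hV : Voisin2003_cupProduct_algebraicClasses)
    (h132 : ∀ ⦃l d : ℕ⦄ ⦃Z W : SchemeOver ℂ⦄, IsSmoothProjective l Z → IsSmoothProjective d W →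
      ∀ ⦃η : complexBetti W 2⦄ (hη : IsPolarizationClass d W η) ⦃b b' : ℕ⦄ (_ : b + b' = d)
      ⦃β : complexBetti W (2 * b)⦄, β ∈ algebraicClasses W b →
        complexBetti.map (snd Z W) (2 * b')
            (lefschetzInvolution hη.hasHardLefschetz (show 2 * b + 2 * b' = 2 * d by omega) β) ∈
          Submodule.span ℂ {s : complexBetti (Z ⊗ W) (2 * b') |
            ∃ (θ : complexBetti (Z ⊗ W) 2) (hθ : IsPolarizationClass (l + d) (Z ⊗ W) θ) (c e e' : ℕ)
              (_ : c + e' = b') (_ : e + e' = l + d) (γ : complexBetti (Z ⊗ W) (2 * c))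
              (δ : complexBetti (Z ⊗ W) (2 * e)),
              γ ∈ algebraicClasses (Z ⊗ W) c ∧ δ ∈ algebraicClasses (Z ⊗ W) e ∧
                s = cupProduct (show 2 * c + 2 * e' = 2 * b' by omega) γ
                  (lefschetzInvolution hθ.hasHardLefschetz
                    (show 2 * e + 2 * e' = 2 * (l + d) by omega) δ)})
    ⦃l n m : ℕ⦄ ⦃Z X Y : SchemeOver ℂ⦄ (hZ : IsSmoothProjective l Z) (hX : IsSmoothProjective n X)
    (hY : IsSmoothProjective m Y) (μ : OrientationFamily) ⦃η : complexBetti (X ⊗ Y) 2⦄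
    (hη : IsPolarizationClass (n + m) (X ⊗ Y) η) ⦃a b b' p : ℕ⦄ (hbb' : b + b' = n + m)
    (hab : a + b' = p + m) (hp : p ≤ n) ⦃α : complexBetti (X ⊗ Y) (2 * a)⦄
    ⦃β : complexBetti (X ⊗ Y) (2 * b)⦄ (hα : α ∈ algebraicClasses (X ⊗ Y) a)
    (hβ : β ∈ algebraicClasses (X ⊗ Y) b) :
    complexGysin μ (IsSmoothProjective.tensor_holds hZ (IsSmoothProjective.tensor_holds hX hY))
        (IsSmoothProjective.tensor_holds hZ hX) (Z ◁ fst X Y)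
        (show 2 * (p + m) + 2 * (l + n) = 2 * p + 2 * (l + (n + m)) by omega)
        (cupProduct (show 2 * a + 2 * b' = 2 * (p + m) by omega)
          (complexBetti.map (snd Z (X ⊗ Y)) (2 * a) α)
          (complexBetti.map (snd Z (X ⊗ Y)) (2 * b')
            (lefschetzInvolution hη.hasHardLefschetz (show 2 * b + 2 * b' = 2 * (n + m) by omega) β))) ∈
      motivatedClasses (l + n) (Z ⊗ X) p := by
  classical
  have hμ : μ.HasPoincareDuality := OrientationFamily.hasPoincareDuality μ
  have hW : IsSmoothProjective (n + m) (X ⊗ Y) := IsSmoothProjective.tensor_holds hX hY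
  have hA : IsSmoothProjective (l + (n + m)) (Z ⊗ (X ⊗ Y)) := IsSmoothProjective.tensor_holds hZ hW
  have hZX : IsSmoothProjective (l + n) (Z ⊗ X) := IsSmoothProjective.tensor_holds hZ hX
  have hB : IsSmoothProjective (l + (n + m)) ((Z ⊗ X) ⊗ Y) := by
    rw [← Nat.add_assoc]
    exact IsSmoothProjective.tensor_holds hZX hY
  have h₃ : 2 * a + 2 * b' = 2 * (p + m) := by omega
  have H : 2 * (p + m) + 2 * (l + n) = 2 * p + 2 * (l + (n + m)) := by omega
  -- linearity in `pr^*(*_η β)`: reduce to the spanning classes `γ ∪ *_θ δ`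
  suffices hle : Submodule.span ℂ {s : complexBetti (Z ⊗ (X ⊗ Y)) (2 * b') |
      ∃ (θ : complexBetti (Z ⊗ (X ⊗ Y)) 2) (hθ : IsPolarizationClass (l + (n + m)) (Z ⊗ (X ⊗ Y)) θ)
        (c e e' : ℕ) (_ : c + e' = b') (_ : e + e' = l + (n + m))
        (γ : complexBetti (Z ⊗ (X ⊗ Y)) (2 * c)) (δ : complexBetti (Z ⊗ (X ⊗ Y)) (2 * e)),
        γ ∈ algebraicClasses (Z ⊗ (X ⊗ Y)) c ∧ δ ∈ algebraicClasses (Z ⊗ (X ⊗ Y)) e ∧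
          s = cupProduct (show 2 * c + 2 * e' = 2 * b' by omega) γ
            (lefschetzInvolution hθ.hasHardLefschetz
              (show 2 * e + 2 * e' = 2 * (l + (n + m)) by omega) δ)} ≤
      (motivatedClasses (l + n) (Z ⊗ X) p).comap
        (complexGysin μ hA hZX (Z ◁ fst X Y) H ∘ₗ
          cupProduct h₃ (complexBetti.map (snd Z (X ⊗ Y)) (2 * a) α)) from
    hle (h132 hZ hW hη hbb' hβ)
  refine Submodule.span_le.2 ?_
  rintro _ ⟨θ, hθ, c, e, e', hce, hee, γ, δ, hγ, hδ, rfl⟩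
  rw [SetLike.mem_coe, Submodule.mem_comap, LinearMap.comp_apply]
  -- `pr^* α ∪ (γ ∪ *_θ δ) = (pr^* α ∪ γ) ∪ *_θ δ`, a point generator of `A_mot^{p+m}(Z ⊗ (X ⊗ Y))`
  have hαγ : cupProduct (two_mul_add_two_mul a c) (complexBetti.map (snd Z (X ⊗ Y)) (2 * a) α) γ ∈
      algebraicClasses (Z ⊗ (X ⊗ Y)) (a + c) :=
    hV hA (map_snd_mem_supportedClasses hZ hW hα) hγ
  have h₅ : 2 * (a + c) + 2 * e' = 2 * (p + m) := by omega
  rw [← cupProduct_assoc (two_mul_add_two_mul a c) (show 2 * c + 2 * e' = 2 * b' by omega) h₅ h₃]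
  set w := cupProduct h₅ (cupProduct (two_mul_add_two_mul a c)
    (complexBetti.map (snd Z (X ⊗ Y)) (2 * a) α) γ)
    (lefschetzInvolution hθ.hasHardLefschetz (show 2 * e + 2 * e' = 2 * (l + (n + m)) by omega) δ)
    with hw_def
  have hw : w ∈ motivatedClasses (l + (n + m)) (Z ⊗ (X ⊗ Y)) (p + m) :=
    (isMotivatedClass_of_eq_cupProduct_lefschetzInvolution hA hθ hee (show a + c + e' = p + m by omega)
      (show p + m ≤ l + (n + m) by omega) h₅ _ hαγ hδ hw_def).mem_motivatedClasses
  -- `Z ◁ pr_X = a⁻¹ ≫ pr_{Z ⊗ X}` for the associator `a`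
  have hfac : Z ◁ fst X Y = (α_ Z X Y).inv ≫ fst (Z ⊗ X) Y :=
    CartesianMonoidalCategory.hom_ext _ _ (by simp) (by simp)
  have hcomp : complexGysin μ hA hZX (Z ◁ fst X Y) H =
      complexGysin μ hB hZX (fst (Z ⊗ X) Y) H ∘ₗ
        complexGysin μ hA hB (α_ Z X Y).inv
          (show 2 * (p + m) + 2 * (l + (n + m)) = 2 * (p + m) + 2 * (l + (n + m)) from rfl) := by
    rw [← complexGysin_comp hμ hA hB hZX (α_ Z X Y).inv (fst (Z ⊗ X) Y) rfl H]
    congr 1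
  rw [hcomp, LinearMap.comp_apply]
  -- `(a⁻¹)_! w` is a multiple of `a^* w`, a motivated class of `(Z ⊗ X) ⊗ Y`
  obtain ⟨c₀, hc₀⟩ := exists_complexGysin_iso_eq_smul_map μ hA hB (α_ Z X Y).symm rfl w
  rw [Iso.symm_hom, Iso.symm_inv] at hc₀
  rw [hc₀, map_smul]
  refine Submodule.smul_mem _ _ ?_
  have hw' : complexBetti.map (α_ Z X Y).hom (2 * (p + m)) w ∈
      motivatedClasses (l + (n + m)) ((Z ⊗ X) ⊗ Y) (p + m) :=
    map_mem_motivatedClasses_of_iso hA hB (α_ Z X Y) hw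
  -- Prop. 2.1 (ii), second inclusion, along `pr_{Z ⊗ X} : (Z ⊗ X) ⊗ Y → Z ⊗ X`
  have key : ∀ (E : ℕ) (_ : E = l + n + m) (hB₁ : IsSmoothProjective E ((Z ⊗ X) ⊗ Y))
      (H₁ : 2 * (p + m) + 2 * (l + n) = 2 * p + 2 * E) (x : complexBetti ((Z ⊗ X) ⊗ Y) (2 * (p + m))),
      x ∈ motivatedClasses E ((Z ⊗ X) ⊗ Y) (p + m) →
        complexGysin μ hB₁ hZX (fst (Z ⊗ X) Y) H₁ x ∈ motivatedClasses (l + n) (Z ⊗ X) p := by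
    rintro E rfl hB₁ H₁ x hx
    exact complexGysin_fst_mem_motivatedClasses μ hZX hY hB₁ H₁ hx
  exact key (l + (n + m)) (Nat.add_assoc l n m).symm hB H _ hw'

end Literature.AlgebraicGeometry.HodgeTheory.MotivatedPullback

end
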